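import Summits.BirchSwinnertonDyer.BirchSwinnertonDyer.Theorems.ResidualThetaTransportAtTwoRlfTwistedEventualPlusLiftOfPoitouTate
import Summits.BirchSwinnertonDyer.BirchSwinnertonDyer.Theorems.ResidualThetaTransportAtTwoRlfTwistedUniformExponentAlt
import HarnessLib

/-!
# Road T for item 23110, brick (R3-PT) — FINAL binder form: `LIFT-ℚ⁺_ev(u)` at `ℚ`, `p = 2` from the `±`-duality for ALTERNATING
# NON-DEGENERATE Weil data (`halt`, `hnondeg`) and the eigen-exponent (sequel of `…RlfTwistedEventualPlusLiftOfPoitouTate`)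

Route `ResidualThetaTransportAtTwo` (RTT, crux r201 `ResidualLambdaFormulaNegDiscAtTwo`, stmt-BirchSwinnertonDyer-23110) /
`ThetaPartnerAtTwo` (TP2). Seat `prover-bsd-wall-tp2-p2x` g12 LEAD (`--supports stmt-BirchSwinnertonDyer-23110`). THEOREMS ONLY (no
definition, no named fact, no `sorry`); closes nothing by itself.

Greenberg (LNM 1716, §4 Lemma 4.6 (p. 107) with Prop. 4.13 and its Remark, pp. 120–124): a class of `H¹(F_Σ/F_∞, A_s)` whose image under
`ψ = u·conj_γ − 1` is a local coboundary is corrected by a class restricted from level `F` with PRESCRIBED LOCAL BEHAVIOUR AT `p` — the input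
`hlift` (LIFT⁺₂) of `SignedEC.TwistedSurj.rlf2_of_twistedDescent`. Its global half at finite level is the following Poitou–Tate statement,
proved here EXACTLY like the eventual Cassels lift (`…RlfTwistedEventualLiftOfPoitouTate`), with the pair of structures
`𝓖^A ≤ 𝓖_rel` (`W.twistedSignedRelaxedSelmerStructure … A` ≤ t42's `W.twistedRelaxedSelmerStructure`: they differ only at `v ∣ p`,
signed local Kummer condition vs everything), whose `SelmerComplement` prescribes the local class at `v ∣ p` MODULO the signed local Kummer
condition — the exact prescription being impossible (the local condition at `p` has corank `2`, the global group corank `1`):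

* `exists_mem_selmerGroup_relaxed_res_sub_mem_localKummer_of_poitouTate` — for every `J` and local classes `x₂(v) ∈ H¹(Γ_{K_v}, E[p^J](χ_u))`
  (`v ∣ p`): some `J' ≥ J` and `x ∈ H¹(K_Σ/K, E[p^{J'}](χ_u))` (`= H¹_{𝓖_rel}`) with `res_v x − H¹(ι) x₂(v) ∈ twistedTorsionLocalKummer … (A v)` at
  every `v ∣ p` — from `poitouTate_selmerStructure_duality K` and the SAME tower input `htower` as the Cassels lift (the dual Selmer group of
  `𝓖^A` is contained in that of `𝓕^A`);
* `twistedTorsionToH1_mem_unramifiedOutside_of_mem_selmerGroup_relaxed` — read over `K_∞`: `twistedTorsionToH1 x ∈ unramifiedOutside (ker κ) E[p^∞] p S₀`;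
* **`liftPlusEventual_two_of_plusDualNondeg_of_eigen`** — `LIFT-ℚ⁺_ev(u)` at `ℚ`, `p = 2` from `hdual` + `hfinE` alone: the global input of
  w3's LIFT⁺₂ assembly (`…RlfTwistedPlusLocEngine.exists_twistedTorsion_localLift_plusKummer_two` supplies the local class `x₂` at `2`;
  NOTE the prescription is modulo `twistedTorsionLocalKummer`, so the local engine must be consumed in the «`res_2 y − x ∈ L⁺`» form).

HONEST FRAMING: closes nothing; `hdual` (Kim 2007 Prop. 3.18 read at 2, twisted, level ℚ) and `hfinE` are NOT proved here; 23110 is NOT proved;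
BSD is not proved by any of this. References: [GreenbergLNM1716] §4 Lemma 4.6 (p. 107), Prop. 4.13 + Remark (pp. 120–122), p. 124;
[Howard2004HeegnerKolyvagin] Thm. 2.1.11; [Kobayashi2003] Def. 1.1.
-/

-- the Theorems namespace of this sub repeats the summit name by design (D-0017 nested layout)
set_option linter.dupNamespace false

noncomputable section

open scoped Classical NumberField

open NumberField IsDedekindDomain Field
open Literature.NumberTheory.EllipticCurves Literature.NumberTheory.GaloisRepresentations
  Literature.NumberTheory.GaloisCohomology WeierstrassCurve ZpExtension Literature.NumberTheory.EllipticCurves.Kobayashi2003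
  Literature.NumberTheory.EllipticCurves.GreenbergVatsal2000
open Literature.NumberTheory.GaloisRepresentations.DiscreteGaloisModule (localTatePairingZMod unramifiedSubgroup
  SelmerStructure TateDual tateDual)

namespace Summit.BirchSwinnertonDyer.BirchSwinnertonDyer.Theorems.SignedEC.TwistedPT

/-! ## `K = ℚ`, `p = 2`: the tower input and `LIFT-ℚ⁺_ev(u)` from the `±`-duality and the eigen-exponent alone -/

/-- **`LIFT-ℚ⁺_ev(u)` at `ℚ`, `p = 2`, from the `±`-duality and the eigen-exponent alone**: for every level `J` and local classes `x₂(v)` at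
the places `v ∋ 2`, some `J' ≥ J` and `x ∈ H¹(Γ_ℚ, E[2^{J'}](χ_u))` with `twistedTorsionToH1 x ∈ H¹(ℚ_Σ/ℚ_∞, E[2^∞]) = unramifiedOutside S₀` and
`res_v x − H¹(ι) x₂(v)` in the signed local Kummer condition at every `v ∋ 2` — the global input of LIFT⁺₂(u) (w3's local engine
`exists_twistedTorsion_localLift_plusKummer_two` supplies `x₂`). [cite: GreenbergLNM1716, §4 Lemma 4.6 (p. 107), p. 124] -/
theorem liftPlusEventual_two_of_plusDualAlt_of_eigen (E : WeierstrassCurve ℚ) [E.IsElliptic] [E.IsGloballyMinimal]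
    (hss : Rank1Residual.GoodSS E 2) (S₀ : Finset (HeightOneSpectrum (𝓞 ℚ))) (κ : ZpExtension ℚ 2)
    {γ : Field.absoluteGaloisGroup ℚ} (hγ : κ.IsTopGenerator γ) (u : ℤ) (hu : (2 : ℤ) ∣ u - 1) (ε : ℤˣ)
    (hS2 : ∀ v ∈ S₀, ((2 : ℕ) : 𝓞 ℚ) ∉ v.asIdeal)
    (hS : ∀ v : HeightOneSpectrum (𝓞 ℚ), ¬ E.HasGoodReductionAt v → v ∈ S₀)
    (hdual : ∀ (J : ℕ) (u' : ℤ) (hu' : (2 : ℤ) ∣ u' - 1) (huu' : ((2 : ℤ) ^ J) ∣ u * u' - 1)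
      (e : E.geomTorsion ((2 ^ J : ℕ) : ℤ) → E.geomTorsion ((2 ^ J : ℕ) : ℤ) → AlgebraicClosure ℚ)
      (hμ : ∀ S T, e S T ^ (2 ^ J) = 1) (hadd₁ : ∀ S₁ S₂ T, e (S₁ + S₂) T = e S₁ T * e S₂ T)
      (hadd₂ : ∀ S T₁ T₂, e S (T₁ + T₂) = e S T₁ * e S T₂)
      (hgal : ∀ (σ : absoluteGaloisGroup ℚ) (S T : E.geomTorsion ((2 ^ J : ℕ) : ℤ)), σ • e S T = e (σ • S) (σ • T))
      (halt : ∀ T, e T T = 1) (hnondeg : ∀ T, (∀ S, e S T = 1) → T = 0)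
      [Finite (E.geomTorsion ((2 ^ J : ℕ) : ℤ))]
      (inv : LocalInvariants ℚ (2 ^ J)), inv.IsPerfect → inv.SumLocalTermEqZero → inv.UnramifiedOrthogonal →
      ∀ (v : HeightOneSpectrum (𝓞 ℚ)), ((2 : ℕ) : 𝓞 ℚ) ∈ v.asIdeal →
      ∀ y' : galoisCohomology ((E.twistedTorsionGaloisModule 2 κ J u' hu').restrictField (v.adicCompletion ℚ)) 1,
        galoisCohomology.map ((E.twistedWeilDual 2 κ J hu hu' huu' e hμ hadd₁ hadd₂ hgal).restrictField (v.adicCompletion ℚ)) 1 y' ∈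
            inv.dualLocalCondition (E.twistedTorsionGaloisModule 2 κ J u hu) (Sum.inr v)
              (E.twistedTorsionLocalKummer 2 κ J u hu (v.adicCompletion ℚ)
                (⨆ n : ℕ, signedLocalPoints κ (v.adicCompletion ℚ) E ε n)) →
        y' ∈ E.twistedTorsionLocalKummer 2 κ J u' hu' (v.adicCompletion ℚ) (⨆ n : ℕ, signedLocalPoints κ (v.adicCompletion ℚ) E ε n))
    (hfinE : ∃ e : ℕ, ∀ c ∈ unramifiedOutside κ.kerSubgroup ↥(E.geomPrimaryTorsion 2) 2 (↑S₀ : Set (HeightOneSpectrum (𝓞 ℚ))) ⊓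
        ⨅ (v : HeightOneSpectrum (𝓞 ℚ)) (_ : ((2 : ℕ) : 𝓞 ℚ) ∈ v.asIdeal) (σ : Field.absoluteGaloisGroup ℚ),
          (localKummerOverOfEmb E 2 κ.kerSubgroup (closureEmb (K := ℚ) (v.adicCompletion ℚ))
            (⨆ n : ℕ, signedLocalPoints κ (v.adicCompletion ℚ) E ε n)).comap (E.conjH1 2 κ.kerSubgroup σ),
      E.conjH1 2 κ.kerSubgroup γ c = u • c → 2 ^ e • c = 0)
    (J : ℕ) (x₂ : ∀ v : HeightOneSpectrum (𝓞 ℚ),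
      galoisCohomology ((E.twistedTorsionGaloisModule 2 κ J u hu).restrictField (v.adicCompletion ℚ)) 1) :
    ∃ (J' : ℕ) (hJ : J ≤ J') (x : galoisCohomology (E.twistedTorsionGaloisModule 2 κ J' u hu) 1),
      E.twistedTorsionToH1 2 κ J' u hu x ∈
          unramifiedOutside κ.kerSubgroup ↥(E.geomPrimaryTorsion 2) 2 (↑S₀ : Set (HeightOneSpectrum (𝓞 ℚ))) ∧
        ∀ v : HeightOneSpectrum (𝓞 ℚ), ((2 : ℕ) : 𝓞 ℚ) ∈ v.asIdeal →
          galoisCohomology.res (E.twistedTorsionGaloisModule 2 κ J' u hu) (v.adicCompletion ℚ) 1 x -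
              galoisCohomology.map ((E.twistedTorsionIncl 2 κ hJ u hu).restrictField (v.adicCompletion ℚ)) 1 (x₂ v) ∈
            E.twistedTorsionLocalKummer 2 κ J' u hu (v.adicCompletion ℚ) (⨆ n : ℕ, signedLocalPoints κ (v.adicCompletion ℚ) E ε n) := by
  haveI hfin : ∀ J : ℕ, Finite (E.geomTorsion ((2 ^ J : ℕ) : ℤ)) := fun J ↦
    haveI : NeZero (2 ^ J) := ⟨pow_ne_zero _ two_ne_zero⟩
    finite_geomTorsion_of_neZero E (2 ^ J)
  -- the in-tree inputs
  have hPT : poitouTate_selmerStructure_duality ℚ := SchneiderFreeAdditiveX3.PoitouTateReduction.poitouTate_selmerStructure_duality_holds ℚ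
  have hdiv : E.zsmul_geomPoints_surjective := E.zsmul_geomPoints_surjective_holds
  have hgood : ∀ v : HeightOneSpectrum (𝓞 ℚ), v ∉ (↑S₀ : Set (HeightOneSpectrum (𝓞 ℚ))) → ((2 : ℕ) : 𝓞 ℚ) ∉ v.asIdeal →
      E.HasGoodReductionAt v := fun v hv _ ↦ by
    by_contra h; exact hv (Finset.mem_coe.2 (hS v h))
  have hSJ : ∀ (J : ℕ) (v : HeightOneSpectrum (𝓞 ℚ)), (Sum.inr v : Place ℚ) ∉ twistedDescentPlaces (K := ℚ) 2 S₀ →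
      ((2 ^ J : ℕ) : 𝓞 ℚ) ∉ v.asIdeal ∧ GaloisRep.IsUnramifiedAt v (E.twistedTorsionGaloisModule 2 κ J u hu) := by
    intro J v hv
    rw [not_mem_twistedDescentPlaces_iff] at hv
    exact E.natCast_pow_not_mem_and_isUnramifiedAt_twistedTorsionGaloisModule 2 κ J u hu hgood
      (fun h ↦ hv.1 (Finset.mem_coe.1 h)) hv.2
  have hbot := SignedTransportAtTwo.fixedPoints_kerSubgroup_eq_bot_of_goodSS E hss κ
  have hfix : ∀ P : E.geomPrimaryTorsion 2, (∀ h : κ.kerSubgroup, h • P = P) → P = 0 := by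
    intro P hP
    have hmem : P ∈ FixedPoints.addSubgroup κ.kerSubgroup (E.geomPrimaryTorsion 2) := by
      rw [FixedPoints.mem_addSubgroup]; exact hP
    rw [hbot] at hmem
    exact (AddSubgroup.mem_bot).mp hmem
  have hfixJ : ∀ (J : ℕ) (T : E.geomTorsion ((2 ^ J : ℕ) : ℤ)),
      (∀ h : absoluteGaloisGroup ℚ, h ∈ κ.kerSubgroup → h • T = T) → T = 0 := by
    intro J T hT
    have h0 := hfix (AddSubgroup.inclusion
      (Literature.Barriers.BirchSwinnertonDyer.geomTorsion_pow_le_geomPrimaryTorsion E 2 J) T) (fun h ↦ by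
        apply Subtype.ext
        rw [primaryComponent.coe_smul, AddSubgroup.coe_inclusion, Subgroup.smul_def, ← AddSubgroup.torsionBy.coe_smul,
          hT h h.2])
    have h1 := congrArg (fun b : E.geomPrimaryTorsion 2 ↦ (b : E.geomPoints)) h0
    simp only [AddSubgroup.coe_inclusion, ZeroMemClass.coe_zero] at h1
    exact Subtype.ext h1
  -- no twisted invariants in `Hom(ker π, μ)` (Weil pairing)
  have hinv : ∀ (j J : ℕ) (hjJ : j ≤ J) (m : TateDual ℚ (E.geomTorsion ((2 ^ J : ℕ) : ℤ)) (2 ^ J)),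
      (∀ (g : absoluteGaloisGroup ℚ) (R : E.geomTorsion ((2 ^ J : ℕ) : ℤ)), E.twistedTorsionMulPow 2 κ hjJ u hu R = 0 →
        ((E.twistedTorsionGaloisModule 2 κ J u hu).tateDual (2 ^ J) g m - m) R = 0) →
      ∀ R : E.geomTorsion ((2 ^ J : ℕ) : ℤ), E.twistedTorsionMulPow 2 κ hjJ u hu R = 0 → m R = 0 := by
    intro j J hjJ m hm R hR
    rcases Nat.eq_zero_or_pos J with hJ0 | hJpos
    · -- `J = 0`: `E[1] = 0`
      subst hJ0
      have hR0 : R = 0 := Subtype.ext (by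
        have h : ((2 ^ 0 : ℕ) : ℤ) • (R : E.geomPoints) = 0 := (Submodule.mem_torsionBy_iff _ _).mp R.2
        simp only [pow_zero, Nat.cast_one, one_smul] at h
        exact h)
      rw [hR0, map_zero]
    obtain ⟨eW, hμ, hadd₁, hadd₂, halt, hnondeg, hgal⟩ := WeierstrassCurve.exists_weilPairing_holds E (2 ^ J)
      (le_trans (le_refl 2) (Nat.le_self_pow (by omega) 2)) (by exact_mod_cast pow_ne_zero J two_ne_zero)
    obtain ⟨u', hu', huu'⟩ := exists_inverse_twist (p := 2) hu J
    exact E.forall_apply_eq_zero_of_tateDual_sub_apply_eq_zero 2 κ hjJ hu hu' huu' eW hμ hadd₁ hadd₂ hgal hnondeg hdiv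
      (hfixJ J) m hm R hR
  -- the uniform exponent (D5) and the tower (D4c)
  have hexp := uniformExponent_of_plusDualAlt_of_eigen E 2 S₀ κ u hu
    (fun v ↦ ⨆ n : ℕ, signedLocalPoints κ (v.adicCompletion ℚ) E ε n)
    hγ hS2 hSJ hfix (fun J u' hu' huu' e hμ hadd₁ hadd₂ hgal halt hnondeg ↦ hdual J u' hu' huu' e hμ hadd₁ hadd₂ hgal halt hnondeg) hfinE
  have htower := E.tower_of_uniform_exponent 2 κ u hu hdiv
    (fun J ↦ E.twistedSignedSelmerStructure 2 S₀ κ J u hu (fun v ↦ ⨆ n : ℕ, signedLocalPoints κ (v.adicCompletion ℚ) E ε n))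
    hinv hexp
  obtain ⟨J', hJ, x, hx, hxt⟩ := exists_mem_selmerGroup_relaxed_res_sub_mem_localKummer_of_poitouTate E 2 S₀ κ u hu
    (fun v ↦ ⨆ n : ℕ, signedLocalPoints κ (v.adicCompletion ℚ) E ε n) hPT hS2 hSJ htower J x₂
  exact ⟨J', hJ, x, twistedTorsionToH1_mem_unramifiedOutside_of_mem_selmerGroup_relaxed E 2 S₀ κ u hu hx, hxt⟩

end Summit.BirchSwinnertonDyer.BirchSwinnertonDyer.Theorems.SignedEC.TwistedPT

end
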